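import Summits.Parity.GeneralizedHardyLittlewood.Theorems.LeeYangFibresAbsoluteUpgradeDipDefs
import Summits.Parity.GeneralizedHardyLittlewood.Theorems.PairsToGHL.Negative.ShiftPairDictionary
import Summits.Parity.GeneralizedHardyLittlewood.Theorems.PrimeCellsRelative.Negative.FalseWithoutConvexity
import Literature.NumberTheory.Sieve.LinearEquationsInPrimesDimOne
import HarnessLib

/-!
# `AbsoluteUpgrade` (stmt-Parity-14116), line `dip-margin-rate-exchange`: the load-bearing hypotheses of
# the input `FibreHyperbolicityAlong` (negative lemmas)

Negative-side support (refuter cdisprove seat, gen 2) for the crux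
`LeeYangFibres.AbsoluteUpgrade := RelativeDimOne → DimOne` through its picked line
`Cruxes/AbsoluteUpgrade/Lines/dip_margin_rate_exchange.lean`.  After the lead's cycle 1 the line's only
open stubs are the two `RelativeDimOne`-guarded conjectural inputs; the first is
`stub_fibreHyperbolicityAlong : RelativeDimOne → FibreHyperbolicityAlong`, whose conclusion
(`Theorems/LeeYangFibresAbsoluteUpgradeDipDefs`, the `u`-uniform clause of crux 2 along the schedule
`u = slowDegree N`) is a promote-stub candidate.  This file records, sorry-free and unconditionally, which
hypotheses of that clause are LOAD-BEARING — each variant below (stated inline; no proposition is defined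
under `Summits/`) is FALSE:

* `fibreHyperbolicityAlong_false_without_massFloor` — the mass floor `η N ≤ β_∞ ∏_p β_p` cannot be
  weakened to positivity `0 < β_∞ ∏_p β_p`: the one-form system `ψ(n) = n` (`∏_p β_p = 1`) on the convex
  slab `K = [1/3, 2/3] ⊆ [-N, N]` (`β_∞ = 1/3 > 0`) has NO lattice point, so every joint cell vanishes, the
  fibre polynomial is identically `0`, and `ζ = i` is a non-real zero
  (`fibreHyperbolicityAlong_false_without_mass`: a fortiori the floor cannot be dropped).
* `fibreHyperbolicityAlong_false_without_convexity` — convexity of `K` cannot be dropped EVEN AT FULL MASS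
  `β_∞ ∏_p β_p = N`: the box with all lattice points deleted, `K = [-N, N] ∖ ℤ`, is Lebesgue-a.e. the box
  (`β_∞ = N`) and again carries the zero polynomial.
* `fibreHyperbolicityAlong_false_without_fugacityPositivity` — the frozen fugacities must be STRICTLY
  positive: for the twin system `(n, n + 2)` on `[-N, N]` (`β_∞ = N`, `∏_p β_p = 𝔖(2) > 0`, tree
  `Theorems/PairsToGHL/Negative/ShiftPairDictionary`) the fibre in coordinate `0` at `w = (1, 0)` is
  identically `0` (every monomial carries `w_1^{j_1}`, `j_1 ≥ 1`).  The clipping argument's node `w → 0⁺`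
  is a limit, not a point of the statement.
* `exists_jointCell_ne_zero_of_fibreShape` — the positive content hidden in the conclusion shape
  `fibre ζ = 0 → Im ζ = 0`: it forces the fibre polynomial to be non-zero, i.e. SOME joint rough cell of
  `(Ψ, K)` at roughness `N^{1/u}` is inhabited (an almost-prime `t`-tuple in `K`).  Along the schedule this
  is harmless for `N ≥ N₀(t)` (then `slowDegree N` exceeds the sieve limit of dimension `t` and the
  `t`-dimensional sieve supplies rough tuples on bodies of mass `≥ ηN`), but any restatement at promote
  time must keep a mass floor of order `N` (or an explicit `K ∩ ℤ`-content hypothesis) and `0 < w_k`.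

Moral for provers / the planner: the statement sees `K` only through `β_∞` (a measure) and the cells only
through `K ∩ ℤ`; the floor `ηN` + convexity are what tie them, exactly as for `PrimeCellsRelative`
(`Theorems/PrimeCellsRelative/Negative/*`).  This file does NOT refute the crux or the stub (the guarded
stub is irrefutable short of proving `RelativeDimOne`, see `Cruxes/AbsoluteUpgrade/Disproof.lean` §8).
[folklore]
-/

noncomputable section

namespace Summit.Parity.GeneralizedHardyLittlewood.Theorems.AbsoluteUpgrade.Negative

open scoped BigOperators Classical
open MeasureTheory Literature.NumberTheory.Sieve
open Summit.Parity.GeneralizedHardyLittlewood.Cruxes.FibreHyperbolicity.ModelTransfer (jointCell fibre)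
open Summit.Parity.GeneralizedHardyLittlewood.Cruxes.AbsoluteUpgrade.DipMarginRateExchange (slowDegree)
open Summit.Parity.GeneralizedHardyLittlewood.Theorems.PairsToGHL.Negative
  (archFactor_shiftPairSystem singularProduct_shiftPairSystem isNondegenerateSystem_shiftPairSystem_iff
    affLinSize_shiftPairSystem_le)
open Summit.Parity.GeneralizedHardyLittlewood.Theorems.PrimeCellsRelative.Negative.Convexity
  (singularProduct_id)

namespace FibreAlong

/-! ### Empty lattice content kills every fibre -/

/-- All joint cells vanish when no lattice point of the box has its real point in `K`. [folklore] -/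
theorem jointCell_eq_zero_of_forall_not_mem {t N u : ℕ} (Ψ : Fin t → AffLinForm 1)
    {K : Set (Fin 1 → ℝ)} (hK : ∀ n ∈ latticeBox 1 N, realPoint n ∉ K) (j : Fin t → ℕ) :
    jointCell t N u Ψ K j = 0 := by
  unfold jointCell
  rw [Finset.card_eq_zero, Finset.filter_eq_empty_iff]
  intro n hn h
  exact hK n hn h.1

/-- ... hence every fibre polynomial is identically zero. [folklore] -/
theorem fibre_eq_zero_of_forall_not_mem {t N u : ℕ} (Ψ : Fin t → AffLinForm 1)
    {K : Set (Fin 1 → ℝ)} (hK : ∀ n ∈ latticeBox 1 N, realPoint n ∉ K) (i : Fin t)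
    (w : Fin t → ℝ) (ζ : ℂ) : fibre t N u Ψ K i w ζ = 0 := by
  unfold fibre
  refine Finset.sum_eq_zero fun j _ => ?_
  rw [jointCell_eq_zero_of_forall_not_mem Ψ hK j]
  simp

/-- **The positive content of the conclusion shape.** If every zero of the fibre polynomial is real, the
polynomial is not identically zero, so some joint rough cell with index in `[1, u]^t` is inhabited.
[folklore] -/
theorem exists_jointCell_ne_zero_of_fibreShape {t N u : ℕ} {Ψ : Fin t → AffLinForm 1}
    {K : Set (Fin 1 → ℝ)} {i : Fin t} {w : Fin t → ℝ}
    (h : ∀ ζ : ℂ, fibre t N u Ψ K i w ζ = 0 → ζ.im = 0) :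
    ∃ j ∈ Fintype.piFinset (fun _ : Fin t => Finset.Icc 1 u), jointCell t N u Ψ K j ≠ 0 := by
  by_contra hall
  push Not at hall
  have h0 : fibre t N u Ψ K i w Complex.I = 0 := by
    unfold fibre
    refine Finset.sum_eq_zero fun j hj => ?_
    rw [hall j hj]
    simp
  have := h Complex.I h0
  simp at this

/-! ### The witnesses -/

/-- No lattice point has its real point in the slab `[1/3, 2/3]`. [folklore] -/
theorem realPoint_not_mem_middleThird (n : Fin 1 → ℤ) :
    realPoint n ∉ Set.Icc (fun _ : Fin 1 => (1 / 3 : ℝ)) (fun _ => 2 / 3) := by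
  rintro ⟨h1, h2⟩
  have h1' : (1 / 3 : ℝ) ≤ (n 0 : ℝ) := h1 0
  have h2' : (n 0 : ℝ) ≤ 2 / 3 := h2 0
  have h3 : (0 : ℤ) < n 0 := by
    have : (0 : ℝ) < (n 0 : ℝ) := by linarith
    exact_mod_cast this
  have h4 : (1 : ℝ) ≤ (n 0 : ℝ) := by exact_mod_cast h3
  linarith

/-- The slab lies in the box `[-N, N]` once `N ≥ 1`. [folklore] -/
theorem middleThird_subset_realBox {N : ℕ} (hN : 1 ≤ N) :
    Set.Icc (fun _ : Fin 1 => (1 / 3 : ℝ)) (fun _ => 2 / 3) ⊆ realBox 1 N := by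
  rintro x ⟨h1, h2⟩
  have hN' : (1 : ℝ) ≤ N := by exact_mod_cast hN
  refine ⟨fun i => ?_, fun i => ?_⟩
  · have hi : (1 / 3 : ℝ) ≤ x i := h1 i
    show -(N : ℝ) ≤ x i
    linarith
  · have hi : x i ≤ 2 / 3 := h2 i
    show x i ≤ (N : ℝ)
    linarith

/-- `β_∞(ψ = n, [1/3, 2/3]) = 1/3`. [folklore] -/
theorem archFactor_id_middleThird :
    archFactor (fun _ : Fin 1 => (⟨fun _ => 1, 0⟩ : AffLinForm 1))
      (Set.Icc (fun _ : Fin 1 => (1 / 3 : ℝ)) (fun _ => 2 / 3)) = 1 / 3 := by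
  rw [DimOne.archFactor_eq]
  have hset : {r : ℝ | (fun _ : Fin 1 => r) ∈ Set.Icc (fun _ : Fin 1 => (1 / 3 : ℝ)) (fun _ => 2 / 3) ∧
      ∀ _i : Fin 1, 0 < (⟨fun _ => 1, 0⟩ : AffLinForm 1).realEval (fun _ => r)} =
        Set.Icc (1 / 3 : ℝ) (2 / 3) := by
    ext r
    simp only [Set.mem_setOf_eq, Set.mem_Icc, Pi.le_def, DimOne.realEval_eq, Int.cast_one, one_mul,
      Int.cast_zero, add_zero, forall_const]
    constructor
    · rintro ⟨⟨h1, h2⟩, -⟩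
      exact ⟨h1, h2⟩
    · rintro ⟨h1, h2⟩
      exact ⟨⟨h1, h2⟩, by linarith⟩
  rw [hset, Real.volume_Icc, ENNReal.toReal_ofReal (by norm_num)]
  norm_num

/-- `β_∞(ψ = n, [-N, N] ∖ ℤ) = N`: the deleted set is countable, hence Lebesgue-null. [folklore] -/
theorem archFactor_id_boxMinusLattice (N : ℕ) :
    archFactor (fun _ : Fin 1 => (⟨fun _ => 1, 0⟩ : AffLinForm 1))
      (realBox 1 (N : ℝ) \ {x : Fin 1 → ℝ | ∃ m : ℤ, x = fun _ => (m : ℝ)}) = N := by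
  rw [DimOne.archFactor_eq]
  have hset : {r : ℝ | (fun _ : Fin 1 => r) ∈
      realBox 1 (N : ℝ) \ {x : Fin 1 → ℝ | ∃ m : ℤ, x = fun _ => (m : ℝ)} ∧
      ∀ _i : Fin 1, 0 < (⟨fun _ => 1, 0⟩ : AffLinForm 1).realEval (fun _ => r)} =
        Set.Ioc 0 (N : ℝ) \ {r : ℝ | ∃ m : ℤ, r = m} := by
    ext r
    simp only [Set.mem_setOf_eq, Set.mem_sdiff, realBox, Set.mem_Icc, Pi.le_def,
      DimOne.realEval_eq, Int.cast_one, one_mul, Int.cast_zero, add_zero, forall_const,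
      Set.mem_Ioc]
    have hiff : (∃ m : ℤ, (fun _ : Fin 1 => r) = fun _ => (m : ℝ)) ↔ ∃ m : ℤ, r = m := by
      constructor
      · rintro ⟨m, h⟩
        exact ⟨m, congr_fun h 0⟩
      · rintro ⟨m, h⟩
        exact ⟨m, funext fun _ => h⟩
    rw [hiff]
    constructor
    · rintro ⟨⟨⟨-, h2⟩, h3⟩, h4⟩
      exact ⟨⟨h4, h2⟩, h3⟩
    · rintro ⟨⟨h1, h2⟩, h3⟩
      exact ⟨⟨⟨by linarith [Nat.cast_nonneg (α := ℝ) N], h2⟩, h3⟩, h1⟩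
  have hnull : volume {r : ℝ | ∃ m : ℤ, r = m} = 0 := by
    refine Set.Countable.measure_zero ?_ volume
    refine (Set.countable_range (Int.cast : ℤ → ℝ)).mono ?_
    rintro r ⟨m, rfl⟩
    exact ⟨m, rfl⟩
  rw [hset, measure_sdiff_null hnull, Real.volume_Ioc, ENNReal.toReal_ofReal (by simp)]
  simp

/-- Every lattice point's real point is deleted from `[-N, N] ∖ ℤ`. [folklore] -/
theorem realPoint_not_mem_boxMinusLattice (N : ℕ) (n : Fin 1 → ℤ) :
    realPoint n ∉ realBox 1 (N : ℝ) \ {x : Fin 1 → ℝ | ∃ m : ℤ, x = fun _ => (m : ℝ)} := by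
  rintro ⟨-, h⟩
  exact h ⟨n 0, funext fun j => by rw [Fin.fin_one_eq_zero j]; rfl⟩

/-- The one-form system `ψ(n) = n` is non-degenerate. [folklore] -/
theorem isNondegenerateSystem_id :
    IsNondegenerateSystem (fun _ : Fin 1 => (⟨fun _ => 1, 0⟩ : AffLinForm 1)) := by
  refine ⟨fun i h0 => ?_, fun i j hij => absurd (Subsingleton.elim i j) hij⟩
  have := congr_fun h0 0
  simp at this

/-- `‖(n)‖_N = 1`. [folklore] -/
theorem affLinSize_id (N : ℕ) :
    affLinSize (fun _ : Fin 1 => (⟨fun _ => 1, 0⟩ : AffLinForm 1)) (N : ℝ) ≤ ((1 : ℕ) : ℝ) := by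
  simp [affLinSize]

/-- For the twin system `(n, n+2)` the fibre in coordinate `0` at the frozen fugacity `w₁ = 0` is
identically zero: every monomial carries the factor `w₁^{j₁}` with `j₁ ≥ 1`. [folklore] -/
theorem fibre_twin_eq_zero_of_fugacity_zero (N u : ℕ) (K : Set (Fin 1 → ℝ)) (ζ : ℂ) :
    fibre 2 N u (shiftPairSystem 2) K 0 (fun k => if k = 0 then 1 else 0) ζ = 0 := by
  unfold fibre
  refine Finset.sum_eq_zero fun j hj => ?_
  have hj1 : 1 ≤ j 1 := (Finset.mem_Icc.mp (Fintype.mem_piFinset.mp hj 1)).1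
  have hj1' : j 1 ≠ 0 := by omega
  rw [Fin.prod_univ_two]
  simp [zero_pow hj1']

end FibreAlong

open FibreAlong

/-- **The mass floor of `FibreHyperbolicityAlong` cannot be weakened to positivity of the mass.**
The variant with `η N ≤ β_∞ ∏_p β_p` replaced by `0 < β_∞ ∏_p β_p` fails at `t = 1`, `L = 1`: the system
`ψ(n) = n` on the convex slab `[1/3, 2/3] ⊆ [-N, N]` has mass `1/3 · 1 > 0`, no lattice point, all joint
cells `0`, and the zero fibre polynomial vanishes at `ζ = i`. [folklore] -/
theorem fibreHyperbolicityAlong_false_without_massFloor :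
    ¬ (∀ (t L : ℕ), 1 ≤ t → ∃ N₀ : ℕ, ∀ N : ℕ, N₀ ≤ N →
        ∀ Ψ : Fin t → AffLinForm 1, IsNondegenerateSystem Ψ → affLinSize Ψ N ≤ L →
        ∀ K : Set (Fin 1 → ℝ), Convex ℝ K → K ⊆ realBox 1 N →
        0 < archFactor Ψ K * singularProduct Ψ →
        ∀ i : Fin t, ∀ w : Fin t → ℝ, (∀ k, 0 < w k ∧ w k ≤ 1) →
        ∀ ζ : ℂ, fibre t N (slowDegree N) Ψ K i w ζ = 0 → ζ.im = 0) := by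
  intro h
  obtain ⟨N₀, hN₀⟩ := h 1 1 le_rfl
  have hb := hN₀ (max N₀ 1) (le_max_left _ _) (fun _ => ⟨fun _ => 1, 0⟩) isNondegenerateSystem_id
    (affLinSize_id _) (Set.Icc (fun _ : Fin 1 => (1 / 3 : ℝ)) (fun _ => 2 / 3)) (convex_Icc _ _)
    (middleThird_subset_realBox (le_max_right _ _)) ?_ 0 (fun _ => 1) (fun _ => ⟨one_pos, le_rfl⟩)
    Complex.I (fibre_eq_zero_of_forall_not_mem _ (fun n _ => realPoint_not_mem_middleThird n) _ _ _)
  · simp at hb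
  · rw [archFactor_id_middleThird, singularProduct_id]
    norm_num

/-- **A fortiori the mass floor cannot be dropped.** [folklore] -/
theorem fibreHyperbolicityAlong_false_without_mass :
    ¬ (∀ (t L : ℕ), 1 ≤ t → ∃ N₀ : ℕ, ∀ N : ℕ, N₀ ≤ N →
        ∀ Ψ : Fin t → AffLinForm 1, IsNondegenerateSystem Ψ → affLinSize Ψ N ≤ L →
        ∀ K : Set (Fin 1 → ℝ), Convex ℝ K → K ⊆ realBox 1 N →
        ∀ i : Fin t, ∀ w : Fin t → ℝ, (∀ k, 0 < w k ∧ w k ≤ 1) →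
        ∀ ζ : ℂ, fibre t N (slowDegree N) Ψ K i w ζ = 0 → ζ.im = 0) := by
  intro h
  refine fibreHyperbolicityAlong_false_without_massFloor fun t L ht => ?_
  obtain ⟨N₀, hN₀⟩ := h t L ht
  exact ⟨N₀, fun N hN Ψ hΨ hL K hK hKN _ => hN₀ N hN Ψ hΨ hL K hK hKN⟩

/-- **Convexity of `K` cannot be dropped from `FibreHyperbolicityAlong`, even at full mass.** Without
`Convex ℝ K`, at `t = 1`, `L = 1`, `η = 1`: the system `ψ(n) = n` (`∏_p β_p = 1`) on the box with its
lattice points deleted, `K = [-N, N] ∖ ℤ` (`β_∞ = N`, so `η N ≤ β_∞ ∏_p β_p`), has all joint cells `0` and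
the zero fibre polynomial vanishes at `ζ = i`. [folklore] -/
theorem fibreHyperbolicityAlong_false_without_convexity :
    ¬ (∀ (t L : ℕ), 1 ≤ t → ∀ η : ℝ, 0 < η → ∃ N₀ : ℕ, ∀ N : ℕ, N₀ ≤ N →
        ∀ Ψ : Fin t → AffLinForm 1, IsNondegenerateSystem Ψ → affLinSize Ψ N ≤ L →
        ∀ K : Set (Fin 1 → ℝ), K ⊆ realBox 1 N →
        η * (N : ℝ) ≤ archFactor Ψ K * singularProduct Ψ →
        ∀ i : Fin t, ∀ w : Fin t → ℝ, (∀ k, 0 < w k ∧ w k ≤ 1) →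
        ∀ ζ : ℂ, fibre t N (slowDegree N) Ψ K i w ζ = 0 → ζ.im = 0) := by
  intro h
  obtain ⟨N₀, hN₀⟩ := h 1 1 le_rfl 1 one_pos
  have hb := hN₀ N₀ le_rfl (fun _ => ⟨fun _ => 1, 0⟩) isNondegenerateSystem_id (affLinSize_id _)
    (realBox 1 (N₀ : ℝ) \ {x : Fin 1 → ℝ | ∃ m : ℤ, x = fun _ => (m : ℝ)}) Set.sdiff_subset ?_ 0
    (fun _ => 1) (fun _ => ⟨one_pos, le_rfl⟩) Complex.I
    (fibre_eq_zero_of_forall_not_mem _ (fun n _ => realPoint_not_mem_boxMinusLattice N₀ n) _ _ _)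
  · simp at hb
  · rw [archFactor_id_boxMinusLattice, singularProduct_id]
    simp

/-- **The frozen fugacities of `FibreHyperbolicityAlong` must be strictly positive.** With
`0 < w_k` weakened to `0 ≤ w_k`, at `t = 2`, `L = 3`, `η = 𝔖(2)/2`: the twin system `(n, n + 2)` on
`K = [-N, N]` (`β_∞ = N`, `∏_p β_p = 𝔖(2) > 0`) has, in coordinate `0` at `w = (1, 0)`, the zero fibre
polynomial, which vanishes at `ζ = i`. [folklore] -/
theorem fibreHyperbolicityAlong_false_without_fugacityPositivity :
    ¬ (∀ (t L : ℕ), 1 ≤ t → ∀ η : ℝ, 0 < η → ∃ N₀ : ℕ, ∀ N : ℕ, N₀ ≤ N →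
        ∀ Ψ : Fin t → AffLinForm 1, IsNondegenerateSystem Ψ → affLinSize Ψ N ≤ L →
        ∀ K : Set (Fin 1 → ℝ), Convex ℝ K → K ⊆ realBox 1 N →
        η * (N : ℝ) ≤ archFactor Ψ K * singularProduct Ψ →
        ∀ i : Fin t, ∀ w : Fin t → ℝ, (∀ k, 0 ≤ w k ∧ w k ≤ 1) →
        ∀ ζ : ℂ, fibre t N (slowDegree N) Ψ K i w ζ = 0 → ζ.im = 0) := by
  intro h
  have hS : 0 < goldbachSingularSeries 2 := goldbachSingularSeries_pos (by decide)
  obtain ⟨N₀, hN₀⟩ := h 2 3 (by norm_num) (goldbachSingularSeries 2 / 2) (by positivity)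
  have hN2 : 2 ≤ max N₀ 2 := le_max_right _ _
  have hb := hN₀ (max N₀ 2) (le_max_left _ _) (shiftPairSystem 2)
    (isNondegenerateSystem_shiftPairSystem_iff.mpr (by norm_num))
    (by exact_mod_cast affLinSize_shiftPairSystem_le (h := 2) (by omega) hN2)
    (realBox 1 (max N₀ 2 : ℕ)) (convex_Icc _ _) subset_rfl ?_ 0
    (fun k => if k = 0 then 1 else 0) (fun k => by fin_cases k <;> simp) Complex.I
    (fibre_twin_eq_zero_of_fugacity_zero _ _ _ _)
  · simp at hb
  · have hA := archFactor_shiftPairSystem 2 (max N₀ 2)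
    have hSS := singularProduct_shiftPairSystem (h := 2) (by decide) (by decide)
    push_cast at hA hSS ⊢
    rw [hA, hSS]
    have hN : (0 : ℝ) ≤ max (N₀ : ℝ) 2 := le_max_of_le_right (by norm_num)
    nlinarith [mul_nonneg hN hS.le]

end Summit.Parity.GeneralizedHardyLittlewood.Theorems.AbsoluteUpgrade.Negative

end
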